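import Literature.AlgebraicGeometry.HodgeTheory.CartierDivisorChernClass
import Literature.Geometry.Kaehler.HolomorphicStraightening
import Literature.Geometry.Kaehler.AmbientHolAtlasUniv
import Literature.Geometry.Kaehler.LinearSliceIdealChart
import Literature.Geometry.Kaehler.AnalyticSet
import HarnessLib

/-!
# Straightening a transverse flag of hyperplane sections: the re-charted analytification

Layer `Literature/AlgebraicGeometry/HodgeTheory`. Geometric input of Serre's dimension count in
dimension `n` (J.-P. Serre, *Géométrie algébrique et géométrie analytique* (1956), n° 16 Lemme 8;
*Faisceaux algébriques cohérents* (1955), n° 81; D. Mumford, *Abelian Varieties* (1970), §16): on an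
analytification `φ : M → X(ℂ)` (`dim M = n`) carrying the `n` sections `s₀, …, s_{n-1}` of `𝒪_X(H)` of
a transverse flag (`BertiniPencilAnalytic.exists_transverse_flag`: wherever the coordinates
`u_0, …, u_{j-1}` vanish their differentials are jointly onto), every point `c` has

* a frame `frameAt c` of `𝒪_X(H)^an` and a **vanishing prefix** `prefixLen c = j ≤ n`
  (`u_0(c) = ⋯ = u_{j-1}(c) = 0 ≠ u_j(c)`, all read in that frame), and
* a **straightening chart** `flagChart c : M ⇀ ℂⁿ` at `c` (holomorphic implicit function theorem,
  `exists_holStraightening`, followed by the linear isomorphism `ℂʲ × ℂⁿ⁻ʲ ≅ ℂⁿ`, `flagChartEquiv`):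
  holomorphic with holomorphic inverse, with source inside `φ⁻¹(U_{frameAt c})` and inside
  `{u_j ≠ 0}`, and on which **`u_k` IS the `k`-th coordinate for `k < j`** (`flagChart_apply_eq`).

Re-charting `M` by these charts (`flagAtlas`, `AmbientHolAtlasUniv`) gives the SAME complex
manifold `(flagAtlas …).Carrier` on which the chart-convex members of the Cartan–Serre nested Leray
data are convex in straightening charts, so that the linear-slice theorems
(`LinearSliceIdealChart`) discharge the memberwise hypotheses of the flag tower of Čech complexes
(`SerreTheoremAFlag.flagTower`): on a chart set `W` of the re-charted manifold lying over one frame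
`U_{a'}`,

* `TransverseFlag.exists_eq_sum_sectionCoord_mul_of_mul_eq` — **`u_0, …, u_{n-1}` is a regular
  sequence on `𝒪(W)`** (`u_i f ∈ (u_k)_{k<i} 𝒪(W) ⟹ f ∈ (u_k)_{k<i} 𝒪(W)`);
* `TransverseFlag.exists_eq_sum_sectionCoord_mul_of_forall_eq_zero` — **a holomorphic function on
  `W` vanishing on `W ∩ {u = 0}` lies in `(u_0, …, u_{n-1}) 𝒪(W)`**;

by the three cases `i < j` (linear coordinates: `LinearSliceIdealChart`), `i = j` (`u_j` is a unit on
`W`) and `i > j` (`u_j` is among the generators), the change of frame `a' ↔ frameAt c` being a unit.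
Everything is proved; the definitions are `appendLinearEquiv`, `flagChartEquiv`, `frameAt`,
`prefixLen`, `flagChart`, `flagAtlas`.

## References

* J.-P. Serre, *Géométrie algébrique et géométrie analytique*, Ann. Inst. Fourier 6 (1956), n° 16
  Lemme 8. [SerreGAGA1956]
* P. Griffiths, J. Harris, *Principles of Algebraic Geometry* (1978), Ch. 0 §1–§2. [GriffithsHarris1978]
* K. Fritzsche, H. Grauert, *From Holomorphic Functions to Complex Manifolds* (2002), Ch. V §3.
  [FritzscheGrauert2002]
-/

noncomputable section

open scoped Manifold ContDiff Topology
open CategoryTheory AlgebraicGeometry TopologicalSpace Set Function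
open Literature.AlgebraicGeometry.Motives
open Literature.AlgebraicGeometry.Motives.AlgPoints
open Literature.NumberTheory.Transcendental
open Literature.Geometry.Kaehler

namespace Literature.AlgebraicGeometry.HodgeTheory

/-! ### Linear algebra: `ℂᵖ × ℂ^q ≅ ℂ^{p+q} ≅ ℂⁿ` -/

section LinearAlgebra

/-- **`ℂᵖ × ℂ^q ≃ₗ ℂ^{p+q}`** by juxtaposition (`Fin.append`; Mathlib's `Fin.appendEquiv` made
linear). [folklore] -/
def appendLinearEquiv (p q : ℕ) : ((Fin p → ℂ) × (Fin q → ℂ)) ≃ₗ[ℂ] (Fin (p + q) → ℂ) :=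
  { Fin.appendEquiv p q with
    map_add' := fun x y ↦ by
      funext i
      change Fin.append (x.1 + y.1) (x.2 + y.2) i = Fin.append x.1 x.2 i + Fin.append y.1 y.2 i
      induction i using Fin.addCases with
      | left i => simp only [Fin.append_left, Pi.add_apply]
      | right i => simp only [Fin.append_right, Pi.add_apply]
    map_smul' := fun c x ↦ by
      funext i
      change Fin.append (c • x.1) (c • x.2) i = c • Fin.append x.1 x.2 i
      induction i using Fin.addCases with
      | left i => simp only [Fin.append_left, Pi.smul_apply]
      | right i => simp only [Fin.append_right, Pi.smul_apply] }

/-- `appendLinearEquiv` on a left index. [folklore] -/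
@[simp]
theorem appendLinearEquiv_apply_castAdd (p q : ℕ) (v : (Fin p → ℂ) × (Fin q → ℂ)) (k : Fin p) :
    appendLinearEquiv p q v (Fin.castAdd q k) = v.1 k :=
  Fin.append_left v.1 v.2 k

/-- **`ℂʲ × ℂⁿ⁻ʲ ≃L ℂⁿ`** for `j ≤ n` (juxtaposition followed by the re-indexing `Fin (j + (n - j)) ≃ Fin n`;
continuous as every linear map of finite-dimensional spaces). [folklore] -/
def flagChartEquiv (j n : ℕ) (h : j ≤ n) : ((Fin j → ℂ) × (Fin (n - j) → ℂ)) ≃L[ℂ] (Fin n → ℂ) :=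
  ((appendLinearEquiv j (n - j)).trans
    (LinearEquiv.funCongrLeft ℂ ℂ (finCongr (Nat.add_sub_cancel' h)).symm)).toContinuousLinearEquiv

/-- **The first `j` coordinates of `flagChartEquiv (v, w)` are those of `v`.** [folklore] -/
@[simp]
theorem flagChartEquiv_apply_castLE {j n : ℕ} (h : j ≤ n) (v : (Fin j → ℂ) × (Fin (n - j) → ℂ)) (k : Fin j) :
    flagChartEquiv j n h v (Fin.castLE h k) = v.1 k := by
  change Fin.append v.1 v.2 ((finCongr (Nat.add_sub_cancel' h)).symm (Fin.castLE h k)) = v.1 k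
  have hk : (finCongr (Nat.add_sub_cancel' h)).symm (Fin.castLE h k) = Fin.castAdd (n - j) k :=
    Fin.ext rfl
  rw [hk, Fin.append_left]

end LinearAlgebra

/-! ### The differential of a map into `ℂᵖ` is onto when its components' differentials are jointly onto -/

section Pi

variable {E : Type*} [NormedAddCommGroup E] [NormedSpace ℂ E]
  {M : Type*} [TopologicalSpace M] [ChartedSpace E M] {p : ℕ}

/-- **Joint surjectivity of the component differentials is surjectivity of the differential** of a
map `f : M → ℂᵖ` (`d(f_i) = pr_i ∘ df` by the chain rule, and `(pr_i)_i = id`). [folklore] -/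
theorem surjective_mfderiv_of_surjective_pi {f : M → Fin p → ℂ} {x : M}
    (hf : MDifferentiableAt 𝓘(ℂ, E) 𝓘(ℂ, Fin p → ℂ) f x)
    (h : Surjective (ContinuousLinearMap.pi fun i ↦ mfderiv 𝓘(ℂ, E) 𝓘(ℂ, ℂ) (fun y ↦ f y i) x)) :
    Surjective (mfderiv 𝓘(ℂ, E) 𝓘(ℂ, Fin p → ℂ) f x) := by
  have hc : ∀ i, mfderiv 𝓘(ℂ, E) 𝓘(ℂ, ℂ) (fun y ↦ f y i) x =
      (ContinuousLinearMap.proj (R := ℂ) (φ := fun _ : Fin p ↦ ℂ) i).comp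
        (mfderiv 𝓘(ℂ, E) 𝓘(ℂ, Fin p → ℂ) f x) := fun i ↦
    ((ContinuousLinearMap.proj (R := ℂ) (φ := fun _ : Fin p ↦ ℂ) i).hasMFDerivAt.comp x hf.hasMFDerivAt).mfderiv
  intro w
  obtain ⟨v, hv⟩ := h w
  refine ⟨v, funext fun i ↦ ?_⟩
  have hi := congr_fun hv i
  rw [ContinuousLinearMap.pi_apply, hc i] at hi
  exact hi

end Pi

/-! ### The vanishing prefix and the straightening chart at a point -/

namespace TransverseFlag

variable {X : SchemeOver ℂ} [IsIntegral X.left] {n : ℕ}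
  {E : Type} [NormedAddCommGroup E] [NormedSpace ℂ E] [FiniteDimensional ℂ E]
  {M : Type} [TopologicalSpace M] [ChartedSpace E M]
  {φ : M → ComplexPoints X} (hφ : IsAnalytification E X n φ)
  (H : CartierDivisor X.left) {s : Fin n → X.left.functionField} (hs : ∀ j, H.IsSection (s j))

/-- **A frame of `𝒪_X(H)^an` at `c`**: a chart `U_a` of `H` through `φ c`. [folklore] -/
def frameAt (c : M) : H.ι :=
  (H.covers (φ c).pt).choose

omit [TopologicalSpace M] in
/-- `φ c` lies in the chart of the frame at `c`. [folklore] -/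
theorem pt_mem_frameAt (c : M) : (φ c).pt ∈ H.U (frameAt (φ := φ) H c) :=
  (H.covers (φ c).pt).choose_spec

/-- **The vanishing prefix `j = prefixLen c ≤ n`** of the flag at `c`: the least index `j` with
`u_j(c) ≠ 0` (read in the frame at `c`), or `n` if all coordinates vanish at `c`.
[cite: SerreGAGA1956, n° 16 Lemme 8] -/
def prefixLen (c : M) : ℕ :=
  if h : ∃ k : Fin n, H.sectionCoord φ (hs k) (frameAt (φ := φ) H c) c ≠ 0 then
    ((Finset.univ.filter fun k : Fin n ↦ H.sectionCoord φ (hs k) (frameAt (φ := φ) H c) c ≠ 0).min'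
      (by obtain ⟨k, hk⟩ := h; exact ⟨k, Finset.mem_filter.2 ⟨Finset.mem_univ k, hk⟩⟩) : ℕ)
  else n

omit [TopologicalSpace M] in
/-- `prefixLen c ≤ n`. [folklore] -/
theorem prefixLen_le (c : M) : prefixLen (φ := φ) H hs c ≤ n := by
  unfold prefixLen
  split_ifs with h
  · exact (Fin.is_lt _).le
  · exact le_rfl

omit [TopologicalSpace M] in
/-- **The coordinates `u_k`, `k < prefixLen c`, vanish at `c`.** [folklore] -/
theorem sectionCoord_eq_zero_of_lt_prefixLen (c : M) (k : Fin n) (hk : (k : ℕ) < prefixLen (φ := φ) H hs c) :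
    H.sectionCoord φ (hs k) (frameAt (φ := φ) H c) c = 0 := by
  classical
  by_contra hne
  unfold prefixLen at hk
  have h : ∃ k : Fin n, H.sectionCoord φ (hs k) (frameAt (φ := φ) H c) c ≠ 0 := ⟨k, hne⟩
  rw [dif_pos h] at hk
  have hmem : k ∈ Finset.univ.filter fun k : Fin n ↦ H.sectionCoord φ (hs k) (frameAt (φ := φ) H c) c ≠ 0 :=
    Finset.mem_filter.2 ⟨Finset.mem_univ k, hne⟩
  have hle := Finset.min'_le _ k hmem
  exact absurd hk (not_lt.2 (Fin.le_iff_val_le_val.1 hle))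

omit [TopologicalSpace M] in
/-- **The coordinate `u_j`, `j = prefixLen c < n`, does not vanish at `c`.** [folklore] -/
theorem sectionCoord_prefixLen_ne_zero (c : M) (h : prefixLen (φ := φ) H hs c < n) :
    H.sectionCoord φ (hs ⟨prefixLen (φ := φ) H hs c, h⟩) (frameAt (φ := φ) H c) c ≠ 0 := by
  classical
  have hex : ∃ k : Fin n, H.sectionCoord φ (hs k) (frameAt (φ := φ) H c) c ≠ 0 := by
    by_contra hne
    unfold prefixLen at h
    rw [dif_neg hne] at h
    exact lt_irrefl n h
  have hval : prefixLen (φ := φ) H hs c =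
      (((Finset.univ.filter fun k : Fin n ↦ H.sectionCoord φ (hs k) (frameAt (φ := φ) H c) c ≠ 0).min'
        ⟨hex.choose, Finset.mem_filter.2 ⟨Finset.mem_univ _, hex.choose_spec⟩⟩ : Fin n) : ℕ) := by
    unfold prefixLen
    rw [dif_pos hex]
  have hmem := Finset.min'_mem (Finset.univ.filter fun k : Fin n ↦
      H.sectionCoord φ (hs k) (frameAt (φ := φ) H c) c ≠ 0)
    ⟨hex.choose, Finset.mem_filter.2 ⟨Finset.mem_univ _, hex.choose_spec⟩⟩
  have heq : (⟨prefixLen (φ := φ) H hs c, h⟩ : Fin n) =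
      (Finset.univ.filter fun k : Fin n ↦ H.sectionCoord φ (hs k) (frameAt (φ := φ) H c) c ≠ 0).min'
        ⟨hex.choose, Finset.mem_filter.2 ⟨Finset.mem_univ _, hex.choose_spec⟩⟩ :=
    Fin.ext hval
  rw [heq]
  exact (Finset.mem_filter.1 hmem).2

variable [IsManifold 𝓘(ℂ, E) ω M]

include hφ in
/-- **The straightening chart of the flag at `c` exists.** With `a = frameAt c`, `j = prefixLen c`
and the transversality of the flag (the differentials of `u_0, …, u_{j-1}` at their common zero `c`
are jointly onto `ℂʲ`), the holomorphic implicit function theorem (`exists_holStraightening`) gives a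
local biholomorphism `e : M ⇀ ℂⁿ` at `c` whose first `j` coordinates are `u_0, …, u_{j-1}`, shrunk
into `φ⁻¹(U_a) ∩ {u_j ≠ 0}`. [cite: GriffithsHarris1978, Ch. 0 §1 and §2 pp. 18–20]
[cite: SerreGAGA1956, n° 16 Lemme 8] -/
theorem exists_flagChart
    (hflag : ∀ (a : H.ι) (m : M) (j : ℕ) (hj : j ≤ n), (φ m).pt ∈ H.U a →
      (∀ i : Fin j, H.sectionCoord φ (hs (Fin.castLE hj i)) a m = 0) →
        Surjective (ContinuousLinearMap.pi fun i : Fin j ↦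
          mfderiv 𝓘(ℂ, E) 𝓘(ℂ, ℂ) (H.sectionCoord φ (hs (Fin.castLE hj i)) a) m))
    (c : M) :
    ∃ e : OpenPartialHomeomorph M (Fin n → ℂ), c ∈ e.source ∧
      e.source ⊆ φ ⁻¹' {P | P.pt ∈ H.U (frameAt (φ := φ) H c)} ∧
      MDifferentiableOn 𝓘(ℂ, E) 𝓘(ℂ, Fin n → ℂ) e e.source ∧
      MDifferentiableOn 𝓘(ℂ, Fin n → ℂ) 𝓘(ℂ, E) e.symm e.target ∧
      (∀ y ∈ e.source, ∀ k : Fin n, (k : ℕ) < prefixLen (φ := φ) H hs c →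
        H.sectionCoord φ (hs k) (frameAt (φ := φ) H c) y = e y k) ∧
      (∀ (h : prefixLen (φ := φ) H hs c < n), ∀ y ∈ e.source,
        H.sectionCoord φ (hs ⟨prefixLen (φ := φ) H hs c, h⟩) (frameAt (φ := φ) H c) y ≠ 0) := by
  set a := frameAt (φ := φ) H c with ha
  set j := prefixLen (φ := φ) H hs c with hjdef
  have hj : j ≤ n := prefixLen_le H hs c
  have hca : (φ c).pt ∈ H.U a := pt_mem_frameAt H c
  -- the open set `U = φ⁻¹(U_a) ∩ {u_j ≠ 0}`
  set U₀ : Set M := φ ⁻¹' {P | P.pt ∈ H.U a} with hU₀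
  have hU₀ : IsOpen U₀ := hφ.isOpen_preimage (H.U a)
  have hu : ∀ k : Fin n, MDifferentiableOn 𝓘(ℂ, E) 𝓘(ℂ, ℂ) (H.sectionCoord φ (hs k) a) U₀ := fun k ↦
    mdifferentiableOn_sectionCoord hφ (hs k) a
  set U : Set M := {y ∈ U₀ | ∀ h : j < n, H.sectionCoord φ (hs ⟨j, h⟩) a y ≠ 0} with hUdef
  have hU : IsOpen U := by
    by_cases hjn : j < n
    · have he : U = U₀ ∩ (H.sectionCoord φ (hs ⟨j, hjn⟩) a) ⁻¹' {0}ᶜ := by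
        ext y
        simp only [hUdef, mem_setOf_eq, mem_inter_iff, mem_preimage, mem_compl_iff, mem_singleton_iff]
        exact ⟨fun h ↦ ⟨h.1, h.2 hjn⟩, fun h ↦ ⟨h.1, fun _ ↦ h.2⟩⟩
      rw [he]
      exact (hu ⟨j, hjn⟩).continuousOn.isOpen_inter_preimage hU₀ isOpen_compl_singleton
    · have he : U = U₀ := by
        ext y
        simp only [hUdef, mem_setOf_eq]
        exact ⟨fun h ↦ h.1, fun h ↦ ⟨h, fun h' ↦ absurd h' hjn⟩⟩
      rw [he]
      exact hU₀
  have hcU : c ∈ U := ⟨hca, fun h ↦ sectionCoord_prefixLen_ne_zero H hs c h⟩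
  -- the map `f = (u_0, …, u_{j-1})`
  set f : M → Fin j → ℂ := fun y i ↦ H.sectionCoord φ (hs (Fin.castLE hj i)) a y with hfdef
  have hf : MDifferentiableOn 𝓘(ℂ, E) 𝓘(ℂ, Fin j → ℂ) f U :=
    (mdifferentiableOn_pi_space (I := 𝓘(ℂ, E))).2 fun i ↦ (hu _).mono fun y hy ↦ hy.1
  have hfc : MDifferentiableAt 𝓘(ℂ, E) 𝓘(ℂ, Fin j → ℂ) f c := (hf c hcU).mdifferentiableAt (hU.mem_nhds hcU)
  have hsurj : Surjective (mfderiv 𝓘(ℂ, E) 𝓘(ℂ, Fin j → ℂ) f c) :=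
    surjective_mfderiv_of_surjective_pi hfc
      (hflag a c j hj hca fun i ↦ sectionCoord_eq_zero_of_lt_prefixLen H hs c _ (Fin.is_lt i))
  have hd : Module.finrank ℂ E = j + (n - j) := by rw [hφ.finrank_eq]; omega
  obtain ⟨e₀, hce₀, he₀U, he₀, he₀s, he₀f⟩ := exists_holStraightening hU hcU hf hsurj hd
  -- compose with `ℂʲ × ℂⁿ⁻ʲ ≅ ℂⁿ`
  set Φ := flagChartEquiv j n hj with hΦ
  refine ⟨e₀.transHomeomorph Φ.toHomeomorph, hce₀, fun y hy ↦ (he₀U hy).1, ?_, ?_, ?_, ?_⟩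
  · -- holomorphy of `Φ ∘ e₀`
    intro y hy
    have h1 : MDifferentiableWithinAt 𝓘(ℂ, E) 𝓘(ℂ, (Fin j → ℂ) × (Fin (n - j) → ℂ)) e₀ e₀.source y := he₀ y hy
    exact ((Φ : ((Fin j → ℂ) × (Fin (n - j) → ℂ)) →L[ℂ] (Fin n → ℂ)).mdifferentiableAt.comp_mdifferentiableWithinAt y h1)
  · -- holomorphy of `e₀⁻¹ ∘ Φ⁻¹`
    intro w hw
    have htgt : ∀ w', w' ∈ (e₀.transHomeomorph Φ.toHomeomorph).target → Φ.symm w' ∈ e₀.target := fun w' hw' ↦ by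
      rw [OpenPartialHomeomorph.transHomeomorph_target] at hw'
      exact hw'
    have h1 : MDifferentiableWithinAt 𝓘(ℂ, (Fin j → ℂ) × (Fin (n - j) → ℂ)) 𝓘(ℂ, E) e₀.symm e₀.target (Φ.symm w) :=
      he₀s _ (htgt w hw)
    have h2 := h1.comp w ((Φ.symm : (Fin n → ℂ) →L[ℂ] ((Fin j → ℂ) × (Fin (n - j) → ℂ))).mdifferentiableWithinAt)
      (fun w' hw' ↦ htgt w' hw')
    exact h2
  · -- the first `j` coordinates
    intro y hy k hk
    have hk' : k = Fin.castLE hj ⟨k, hk⟩ := Fin.ext rfl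
    rw [OpenPartialHomeomorph.transHomeomorph_apply, ContinuousLinearEquiv.coe_toHomeomorph, Function.comp_apply,
      hk', hΦ, flagChartEquiv_apply_castLE, he₀f y hy]
  · -- `u_j ≠ 0` on the source
    intro h y hy
    exact (he₀U hy).2 h

/-- **The straightening chart of the flag at `c`** (a choice in `exists_flagChart`).
[cite: GriffithsHarris1978, Ch. 0 §1 and §2 pp. 18–20] -/
def flagChart
    (hflag : ∀ (a : H.ι) (m : M) (j : ℕ) (hj : j ≤ n), (φ m).pt ∈ H.U a →
      (∀ i : Fin j, H.sectionCoord φ (hs (Fin.castLE hj i)) a m = 0) →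
        Surjective (ContinuousLinearMap.pi fun i : Fin j ↦
          mfderiv 𝓘(ℂ, E) 𝓘(ℂ, ℂ) (H.sectionCoord φ (hs (Fin.castLE hj i)) a) m))
    (c : M) : OpenPartialHomeomorph M (Fin n → ℂ) :=
  (exists_flagChart hφ H hs hflag c).choose

section FlagChart

variable
  (hflag : ∀ (a : H.ι) (m : M) (j : ℕ) (hj : j ≤ n), (φ m).pt ∈ H.U a →
    (∀ i : Fin j, H.sectionCoord φ (hs (Fin.castLE hj i)) a m = 0) →
      Surjective (ContinuousLinearMap.pi fun i : Fin j ↦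
        mfderiv 𝓘(ℂ, E) 𝓘(ℂ, ℂ) (H.sectionCoord φ (hs (Fin.castLE hj i)) a) m))

/-- `c` lies in the source of its straightening chart. [folklore] -/
theorem mem_flagChart_source (c : M) : c ∈ (flagChart hφ H hs hflag c).source :=
  (exists_flagChart hφ H hs hflag c).choose_spec.1

/-- The source of the straightening chart at `c` lies over the frame at `c`. [folklore] -/
theorem flagChart_source_subset (c : M) :
    (flagChart hφ H hs hflag c).source ⊆ φ ⁻¹' {P | P.pt ∈ H.U (frameAt (φ := φ) H c)} :=
  (exists_flagChart hφ H hs hflag c).choose_spec.2.1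

/-- The straightening chart is holomorphic on its source. [folklore] -/
theorem mdifferentiableOn_flagChart (c : M) :
    MDifferentiableOn 𝓘(ℂ, E) 𝓘(ℂ, Fin n → ℂ) (flagChart hφ H hs hflag c) (flagChart hφ H hs hflag c).source :=
  (exists_flagChart hφ H hs hflag c).choose_spec.2.2.1

/-- The inverse of the straightening chart is holomorphic on its target. [folklore] -/
theorem mdifferentiableOn_flagChart_symm (c : M) :
    MDifferentiableOn 𝓘(ℂ, Fin n → ℂ) 𝓘(ℂ, E) (flagChart hφ H hs hflag c).symm (flagChart hφ H hs hflag c).target :=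
  (exists_flagChart hφ H hs hflag c).choose_spec.2.2.2.1

/-- **On the source of the straightening chart at `c`, `u_k` is the `k`-th coordinate for
`k < prefixLen c`** (in the frame at `c`). [cite: GriffithsHarris1978, Ch. 0 §1 and §2 pp. 18–20] -/
theorem flagChart_apply_eq (c : M) {y : M} (hy : y ∈ (flagChart hφ H hs hflag c).source) (k : Fin n)
    (hk : (k : ℕ) < prefixLen (φ := φ) H hs c) :
    H.sectionCoord φ (hs k) (frameAt (φ := φ) H c) y = flagChart hφ H hs hflag c y k :=
  (exists_flagChart hφ H hs hflag c).choose_spec.2.2.2.2.1 y hy k hk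

/-- **On the source of the straightening chart at `c`, `u_j ≠ 0` for `j = prefixLen c < n`** (in
the frame at `c`). [folklore] -/
theorem sectionCoord_prefixLen_ne_zero_of_mem (c : M) (h : prefixLen (φ := φ) H hs c < n) {y : M}
    (hy : y ∈ (flagChart hφ H hs hflag c).source) :
    H.sectionCoord φ (hs ⟨prefixLen (φ := φ) H hs c, h⟩) (frameAt (φ := φ) H c) y ≠ 0 :=
  (exists_flagChart hφ H hs hflag c).choose_spec.2.2.2.2.2 h y hy

/-- **The re-charted analytification**: `M` with the atlas of the straightening charts of the flag
(`AmbientHolAtlas.ofUniv`; the same complex manifold, `AmbientHolAtlasUniv`).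
[cite: GriffithsHarris1978, Ch. 0 §2 pp. 18–20] -/
def flagAtlas : AmbientHolAtlas E (univ : Set M) n :=
  AmbientHolAtlas.ofUniv (flagChart hφ H hs hflag) (mem_flagChart_source hφ H hs hflag)
    (mdifferentiableOn_flagChart hφ H hs hflag) (mdifferentiableOn_flagChart_symm hφ H hs hflag)


/-! ### The memberwise facts on chart sets of the re-charted manifold -/

/-- A chart set of the re-charted manifold at `y₀` lies in the source of the straightening chart at
`val y₀`. [folklore] -/
theorem val_mem_flagChart_source_of_mem_chartSet {y₀ : (flagAtlas hφ H hs hflag).Carrier}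
    {C : Set (Fin n → ℂ)} {x : (flagAtlas hφ H hs hflag).Carrier}
    (hx : x ∈ chartSet 𝓘(ℝ, Fin n → ℂ) y₀ C) :
    (flagAtlas hφ H hs hflag).val x ∈ (flagChart hφ H hs hflag ((flagAtlas hφ H hs hflag).val y₀)).source := by
  have h := chartSet_subset_source 𝓘(ℝ, Fin n → ℂ) y₀ C hx
  rw [flagAtlas, AmbientHolAtlas.extChartAt_ofUniv_source] at h
  exact h

/-- On a chart set at `y₀`, `u_k ∘ val` is the `k`-th coordinate of the extended chart at `y₀`, for
`k < prefixLen (val y₀)` (frame at `val y₀`). [folklore] -/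
theorem sectionCoord_val_eq_extChartAt {y₀ : (flagAtlas hφ H hs hflag).Carrier} {C : Set (Fin n → ℂ)}
    {x : (flagAtlas hφ H hs hflag).Carrier} (hx : x ∈ chartSet 𝓘(ℝ, Fin n → ℂ) y₀ C) (k : Fin n)
    (hk : (k : ℕ) < prefixLen (φ := φ) H hs ((flagAtlas hφ H hs hflag).val y₀)) :
    H.sectionCoord φ (hs k) (frameAt (φ := φ) H ((flagAtlas hφ H hs hflag).val y₀)) ((flagAtlas hφ H hs hflag).val x) =
      extChartAt 𝓘(ℝ, Fin n → ℂ) y₀ x k := by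
  rw [flagChart_apply_eq hφ H hs hflag _ (val_mem_flagChart_source_of_mem_chartSet hφ H hs hflag hx) k hk]
  rfl

variable {ι : Type}

/-- **Change of frame is a unit**: on a chart set `W` at `y₀` lying over `U_{a'}`, the coordinates in
the frame `a'` and in the frame at `val y₀` differ by the transition function of `𝒪_X(H)^an`, a
holomorphic nowhere-vanishing function on `W`. [cite: GortzWedhorn2020, Rem. 11.16 (p. 369)] -/
theorem exists_unit_sectionCoord_eq_mul {y₀ : (flagAtlas hφ H hs hflag).Carrier} {C : Set (Fin n → ℂ)}
    {a' : H.ι}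
    (ha' : ∀ x ∈ chartSet 𝓘(ℝ, Fin n → ℂ) y₀ C, (φ ((flagAtlas hφ H hs hflag).val x)).pt ∈ H.U a') :
    ∃ γ : (flagAtlas hφ H hs hflag).Carrier → ℂ,
      MDifferentiableOn 𝓘(ℂ, Fin n → ℂ) 𝓘(ℂ, ℂ) γ (chartSet 𝓘(ℝ, Fin n → ℂ) y₀ C) ∧
      (∀ x ∈ chartSet 𝓘(ℝ, Fin n → ℂ) y₀ C, γ x ≠ 0) ∧
      ∀ x ∈ chartSet 𝓘(ℝ, Fin n → ℂ) y₀ C, ∀ k : Fin n,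
        H.sectionCoord φ (hs k) a' ((flagAtlas hφ H hs hflag).val x) =
          γ x * H.sectionCoord φ (hs k) (frameAt (φ := φ) H ((flagAtlas hφ H hs hflag).val y₀))
            ((flagAtlas hφ H hs hflag).val x) := by
  set a := frameAt (φ := φ) H ((flagAtlas hφ H hs hflag).val y₀) with ha
  have hxa : ∀ x ∈ chartSet 𝓘(ℝ, Fin n → ℂ) y₀ C, (φ ((flagAtlas hφ H hs hflag).val x)).pt ∈ H.U a := fun x hx ↦
    flagChart_source_subset hφ H hs hflag _ (val_mem_flagChart_source_of_mem_chartSet hφ H hs hflag hx)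
  refine ⟨fun x ↦ (cartierDivisorLineBundle hφ H).coordChange a a' ((flagAtlas hφ H hs hflag).val x), ?_, ?_, ?_⟩
  · have h1 : MDifferentiableOn 𝓘(ℂ, E) 𝓘(ℂ, ℂ) ((cartierDivisorLineBundle hφ H).coordChange a a')
        ((cartierDivisorLineBundle hφ H).baseSet a ∩ (cartierDivisorLineBundle hφ H).baseSet a') :=
      (cartierDivisorLineBundle hφ H).mdifferentiableOn_coordChange a a'
    have h2 := ((flagAtlas hφ H hs hflag).mdifferentiableOn_comp_val_iff (u := (cartierDivisorLineBundle hφ H).coordChange a a')).2 h1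
    exact h2.mono fun x hx ↦ ⟨hxa x hx, ha' x hx⟩
  · intro x hx
    exact (cartierDivisorLineBundle hφ H).coordChange_ne_zero a a' ((flagAtlas hφ H hs hflag).val x) ⟨hxa x hx, ha' x hx⟩
  · intro x hx k
    exact sectionCoord_eq_mul (hs k) (hxa x hx) (ha' x hx)

/-- **`u_0, …, u_{n-1}` is a regular sequence on `𝒪(W)` for every chart set `W` of the re-charted
manifold lying over one frame `U_{a'}`**: if `f` is holomorphic on `W` and
`u_i f = Σ_{k<i} u_k g_k` on `W` (coordinates in the frame `a'`, ANY `g_k`), then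
`f = Σ_{k<i} u_k h_k` on `W` with `h_k` holomorphic on `W`. Cases: `i < j = prefixLen (val y₀)` —
the `u_k`, `k ≤ i`, are linear coordinates of the convex chart piece
(`exists_mdifferentiableOn_eq_sum_mul_of_mul_eq_sum_mul_chartSet`); `i = j` — `u_j` is a unit on
`W`; `i > j` — `u_j` is among the `u_k`, `k < i`. [cite: SerreGAGA1956, n° 16 Lemme 8]
[cite: FritzscheGrauert2002, Ch. V §3] -/
theorem exists_eq_sum_sectionCoord_mul_of_mul_eq (y₀ : (flagAtlas hφ H hs hflag).Carrier)
    {C : Set (Fin n → ℂ)} (hCo : IsOpen C) (hCc : Convex ℝ C)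
    (hCT : C ⊆ (extChartAt 𝓘(ℝ, Fin n → ℂ) y₀).target) {a' : H.ι}
    (ha' : ∀ x ∈ chartSet 𝓘(ℝ, Fin n → ℂ) y₀ C, (φ ((flagAtlas hφ H hs hflag).val x)).pt ∈ H.U a')
    (i : Fin n) {f : (flagAtlas hφ H hs hflag).Carrier → ℂ}
    (hf : MDifferentiableOn 𝓘(ℂ, Fin n → ℂ) 𝓘(ℂ, ℂ) f (chartSet 𝓘(ℝ, Fin n → ℂ) y₀ C))
    {g : Fin n → (flagAtlas hφ H hs hflag).Carrier → ℂ}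
    (hg : ∀ k, MDifferentiableOn 𝓘(ℂ, Fin n → ℂ) 𝓘(ℂ, ℂ) (g k) (chartSet 𝓘(ℝ, Fin n → ℂ) y₀ C))
    (h : ∀ x ∈ chartSet 𝓘(ℝ, Fin n → ℂ) y₀ C,
      H.sectionCoord φ (hs i) a' ((flagAtlas hφ H hs hflag).val x) * f x =
        ∑ k ∈ (Finset.univ : Finset (Fin n)).filter (fun k : Fin n ↦ (k : ℕ) < (i : ℕ)),
          H.sectionCoord φ (hs k) a' ((flagAtlas hφ H hs hflag).val x) * g k x) :
    ∃ h' : Fin n → (flagAtlas hφ H hs hflag).Carrier → ℂ,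
      (∀ k, MDifferentiableOn 𝓘(ℂ, Fin n → ℂ) 𝓘(ℂ, ℂ) (h' k) (chartSet 𝓘(ℝ, Fin n → ℂ) y₀ C)) ∧
      ∀ x ∈ chartSet 𝓘(ℝ, Fin n → ℂ) y₀ C,
        f x = ∑ k ∈ (Finset.univ : Finset (Fin n)).filter (fun k : Fin n ↦ (k : ℕ) < (i : ℕ)),
          H.sectionCoord φ (hs k) a' ((flagAtlas hφ H hs hflag).val x) * h' k x := by
  classical
  set W := chartSet 𝓘(ℝ, Fin n → ℂ) y₀ C with hW
  set a := frameAt (φ := φ) H ((flagAtlas hφ H hs hflag).val y₀) with ha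
  set j := prefixLen (φ := φ) H hs ((flagAtlas hφ H hs hflag).val y₀) with hjdef
  set T : Finset (Fin n) := (Finset.univ : Finset (Fin n)).filter (fun k : Fin n ↦ (k : ℕ) < (i : ℕ)) with hT
  obtain ⟨γ, hγ, hγ0, hγu⟩ := exists_unit_sectionCoord_eq_mul hφ H hs hflag (y₀ := y₀) (C := C) ha'
  -- the relation in the frame `a`
  have h₁ : ∀ x ∈ W, H.sectionCoord φ (hs i) a ((flagAtlas hφ H hs hflag).val x) * f x =
      ∑ k ∈ T, H.sectionCoord φ (hs k) a ((flagAtlas hφ H hs hflag).val x) * g k x := fun x hx ↦ by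
    have hx' := h x hx
    simp only [hγu x hx] at hx'
    have h2 : γ x * (H.sectionCoord φ (hs i) a ((flagAtlas hφ H hs hflag).val x) * f x) =
        γ x * ∑ k ∈ T, H.sectionCoord φ (hs k) a ((flagAtlas hφ H hs hflag).val x) * g k x := by
      rw [Finset.mul_sum]
      calc γ x * (H.sectionCoord φ (hs i) a ((flagAtlas hφ H hs hflag).val x) * f x)
          = γ x * H.sectionCoord φ (hs i) a ((flagAtlas hφ H hs hflag).val x) * f x := by ring
        _ = ∑ k ∈ T, γ x * H.sectionCoord φ (hs k) a ((flagAtlas hφ H hs hflag).val x) * g k x := hx'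
        _ = ∑ k ∈ T, γ x * (H.sectionCoord φ (hs k) a ((flagAtlas hφ H hs hflag).val x) * g k x) :=
            Finset.sum_congr rfl fun k _ ↦ by ring
    exact mul_left_cancel₀ (hγ0 x hx) h2
  -- conversion back to the frame `a'`
  have back : ∀ h₀ : Fin n → (flagAtlas hφ H hs hflag).Carrier → ℂ, (∀ k, MDifferentiableOn 𝓘(ℂ, Fin n → ℂ) 𝓘(ℂ, ℂ) (h₀ k) W) →
      (∀ x ∈ W, f x = ∑ k ∈ T, H.sectionCoord φ (hs k) a ((flagAtlas hφ H hs hflag).val x) * h₀ k x) →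
      ∃ h' : Fin n → (flagAtlas hφ H hs hflag).Carrier → ℂ, (∀ k, MDifferentiableOn 𝓘(ℂ, Fin n → ℂ) 𝓘(ℂ, ℂ) (h' k) W) ∧
        ∀ x ∈ W, f x = ∑ k ∈ T, H.sectionCoord φ (hs k) a' ((flagAtlas hφ H hs hflag).val x) * h' k x := by
    intro h₀ hh₀ hf₀
    refine ⟨fun k x ↦ (γ x)⁻¹ * h₀ k x, fun k ↦ ((hγ.inv hγ0).mul (hh₀ k)), fun x hx ↦ ?_⟩
    rw [hf₀ x hx]
    refine Finset.sum_congr rfl fun k _ ↦ ?_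
    rw [hγu x hx k, mul_comm (γ x) _, mul_assoc, ← mul_assoc (γ x), mul_inv_cancel₀ (hγ0 x hx), one_mul]
  rcases lt_or_ge (i : ℕ) j with hij | hij
  · -- Case `i < j`: linear coordinates
    have hiT : i ∉ T := by simp [hT]
    have hcoord : ∀ k : Fin n, (k : ℕ) ≤ (i : ℕ) → ∀ x ∈ W,
        H.sectionCoord φ (hs k) a ((flagAtlas hφ H hs hflag).val x) =
          (ContinuousLinearMap.proj (R := ℂ) (φ := fun _ : Fin n ↦ ℂ) k) (extChartAt 𝓘(ℝ, Fin n → ℂ) y₀ x) :=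
      fun k hk x hx ↦ sectionCoord_val_eq_extChartAt hφ H hs hflag hx k (lt_of_le_of_lt hk hij)
    have hdual : ∀ k ∈ insert i T, ∀ k' ∈ insert i T,
        (ContinuousLinearMap.proj (R := ℂ) (φ := fun _ : Fin n ↦ ℂ) k) ((Pi.single k' 1 : Fin n → ℂ)) =
          if k = k' then 1 else 0 := fun k _ k' _ ↦ by
      rw [ContinuousLinearMap.proj_apply, Pi.single_apply]
    have hq : ∀ x ∈ W,
        (ContinuousLinearMap.proj (R := ℂ) (φ := fun _ : Fin n ↦ ℂ) i) (extChartAt 𝓘(ℝ, Fin n → ℂ) y₀ x) * f x =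
          ∑ k ∈ T, (ContinuousLinearMap.proj (R := ℂ) (φ := fun _ : Fin n ↦ ℂ) k)
            (extChartAt 𝓘(ℝ, Fin n → ℂ) y₀ x) * g k x := fun x hx ↦ by
      rw [← hcoord i le_rfl x hx, h₁ x hx]
      exact Finset.sum_congr rfl fun k hk ↦ by
        rw [hcoord k (le_of_lt (Finset.mem_filter.1 hk).2) x hx]
    obtain ⟨h₀, hh₀, hfh₀⟩ := exists_mdifferentiableOn_eq_sum_mul_of_mul_eq_sum_mul_chartSet y₀ hCo hCc hCT T
      hiT (fun k ↦ ContinuousLinearMap.proj (R := ℂ) (φ := fun _ : Fin n ↦ ℂ) k) (fun k ↦ Pi.single k 1) hdual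
      hf hq
    refine back h₀ hh₀ fun x hx ↦ ?_
    rw [hfh₀ x hx]
    exact Finset.sum_congr rfl fun k hk ↦ by
      rw [hcoord k (le_of_lt (Finset.mem_filter.1 hk).2) x hx]
  · -- Case `j ≤ i`: `u_j` is a unit on `W`
    have hjn : j < n := lt_of_le_of_lt hij i.is_lt
    set k₀ : Fin n := ⟨j, hjn⟩ with hk₀
    have hunit : ∀ x ∈ W, H.sectionCoord φ (hs k₀) a ((flagAtlas hφ H hs hflag).val x) ≠ 0 := fun x hx ↦
      sectionCoord_prefixLen_ne_zero_of_mem hφ H hs hflag _ hjn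
        (val_mem_flagChart_source_of_mem_chartSet hφ H hs hflag hx)
    have hWa : ∀ x ∈ W, (φ ((flagAtlas hφ H hs hflag).val x)).pt ∈ H.U a := fun x hx ↦
      flagChart_source_subset hφ H hs hflag _ (val_mem_flagChart_source_of_mem_chartSet hφ H hs hflag hx)
    have huk₀ : MDifferentiableOn 𝓘(ℂ, Fin n → ℂ) 𝓘(ℂ, ℂ) (fun x ↦ H.sectionCoord φ (hs k₀) a ((flagAtlas hφ H hs hflag).val x)) W :=
      (((flagAtlas hφ H hs hflag).mdifferentiableOn_comp_val_iff (u := H.sectionCoord φ (hs k₀) a)).2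
        (mdifferentiableOn_sectionCoord hφ (hs k₀) a)).mono fun x hx ↦ hWa x hx
    rcases hij.lt_or_eq with hlt | heq
    · -- `j < i`: `u_j` is among the generators
      have hk₀T : k₀ ∈ T := Finset.mem_filter.2 ⟨Finset.mem_univ _, hlt⟩
      refine back (fun k x ↦ if k = k₀ then (H.sectionCoord φ (hs k₀) a ((flagAtlas hφ H hs hflag).val x))⁻¹ * f x else 0)
        (fun k ↦ ?_) fun x hx ↦ ?_
      · by_cases hk : k = k₀
        · simp only [hk, if_true]
          exact (huk₀.inv hunit).mul hf
        · simp only [hk, if_false]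
          exact mdifferentiableOn_const
      · rw [Finset.sum_eq_single k₀]
        · simp only [if_true]
          field_simp [hunit x hx]
        · intro k _ hk
          simp only [hk, if_false, mul_zero]
        · intro hk
          exact absurd hk₀T hk
    · -- `i = j`: divide by `u_i`
      have hik : i = k₀ := Fin.ext heq.symm
      refine back (fun k x ↦ (H.sectionCoord φ (hs k₀) a ((flagAtlas hφ H hs hflag).val x))⁻¹ * g k x)
        (fun k ↦ (huk₀.inv hunit).mul (hg k)) fun x hx ↦ ?_
      have hx1 := h₁ x hx
      rw [hik] at hx1
      have hne := hunit x hx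
      calc f x = (H.sectionCoord φ (hs k₀) a ((flagAtlas hφ H hs hflag).val x))⁻¹ * (H.sectionCoord φ (hs k₀) a ((flagAtlas hφ H hs hflag).val x) * f x) := by
            field_simp
        _ = (H.sectionCoord φ (hs k₀) a ((flagAtlas hφ H hs hflag).val x))⁻¹ * ∑ k ∈ T, H.sectionCoord φ (hs k) a ((flagAtlas hφ H hs hflag).val x) * g k x := by
            rw [hx1]
        _ = ∑ k ∈ T, H.sectionCoord φ (hs k) a ((flagAtlas hφ H hs hflag).val x) * ((H.sectionCoord φ (hs k₀) a ((flagAtlas hφ H hs hflag).val x))⁻¹ * g k x) := by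
            rw [Finset.mul_sum]
            exact Finset.sum_congr rfl fun k _ ↦ by ring

/-- **A holomorphic function on a chart set `W` of the re-charted manifold vanishing on
`W ∩ {u_0 = ⋯ = u_{n-1} = 0}` lies in `(u_0, …, u_{n-1}) 𝒪(W)`** (`W` lying over one frame `U_{a'}`,
coordinates in that frame). Cases: `prefixLen (val y₀) = n` — the `u_k` are the linear coordinates of
the convex chart piece (`exists_mdifferentiableOn_eq_sum_mul_of_forall_eq_zero_chartSet`);
`prefixLen (val y₀) < n` — `u_j` is a unit on `W`. [cite: SerreGAGA1956, n° 16 Lemme 8]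
[cite: FritzscheGrauert2002, Ch. V §1 Prop. 1.6 and §3] -/
theorem exists_eq_sum_sectionCoord_mul_of_forall_eq_zero (y₀ : (flagAtlas hφ H hs hflag).Carrier)
    {C : Set (Fin n → ℂ)} (hCo : IsOpen C) (hCc : Convex ℝ C)
    (hCT : C ⊆ (extChartAt 𝓘(ℝ, Fin n → ℂ) y₀).target) {a' : H.ι}
    (ha' : ∀ x ∈ chartSet 𝓘(ℝ, Fin n → ℂ) y₀ C, (φ ((flagAtlas hφ H hs hflag).val x)).pt ∈ H.U a')
    {f : (flagAtlas hφ H hs hflag).Carrier → ℂ}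
    (hf : MDifferentiableOn 𝓘(ℂ, Fin n → ℂ) 𝓘(ℂ, ℂ) f (chartSet 𝓘(ℝ, Fin n → ℂ) y₀ C))
    (hf0 : ∀ x ∈ chartSet 𝓘(ℝ, Fin n → ℂ) y₀ C,
      (∀ k : Fin n, H.sectionCoord φ (hs k) a' ((flagAtlas hφ H hs hflag).val x) = 0) → f x = 0) :
    ∃ g : Fin n → (flagAtlas hφ H hs hflag).Carrier → ℂ,
      (∀ k, MDifferentiableOn 𝓘(ℂ, Fin n → ℂ) 𝓘(ℂ, ℂ) (g k) (chartSet 𝓘(ℝ, Fin n → ℂ) y₀ C)) ∧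
      ∀ x ∈ chartSet 𝓘(ℝ, Fin n → ℂ) y₀ C,
        f x = ∑ k : Fin n, H.sectionCoord φ (hs k) a' ((flagAtlas hφ H hs hflag).val x) * g k x := by
  classical
  set W := chartSet 𝓘(ℝ, Fin n → ℂ) y₀ C with hW
  set a := frameAt (φ := φ) H ((flagAtlas hφ H hs hflag).val y₀) with ha
  set j := prefixLen (φ := φ) H hs ((flagAtlas hφ H hs hflag).val y₀) with hjdef
  have hj : j ≤ n := prefixLen_le H hs _
  obtain ⟨γ, hγ, hγ0, hγu⟩ := exists_unit_sectionCoord_eq_mul hφ H hs hflag (y₀ := y₀) (C := C) ha'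
  -- conversion back to the frame `a'`
  have back : ∀ h₀ : Fin n → (flagAtlas hφ H hs hflag).Carrier → ℂ, (∀ k, MDifferentiableOn 𝓘(ℂ, Fin n → ℂ) 𝓘(ℂ, ℂ) (h₀ k) W) →
      (∀ x ∈ W, f x = ∑ k : Fin n, H.sectionCoord φ (hs k) a ((flagAtlas hφ H hs hflag).val x) * h₀ k x) →
      ∃ g : Fin n → (flagAtlas hφ H hs hflag).Carrier → ℂ, (∀ k, MDifferentiableOn 𝓘(ℂ, Fin n → ℂ) 𝓘(ℂ, ℂ) (g k) W) ∧
        ∀ x ∈ W, f x = ∑ k : Fin n, H.sectionCoord φ (hs k) a' ((flagAtlas hφ H hs hflag).val x) * g k x := by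
    intro h₀ hh₀ hf₀
    refine ⟨fun k x ↦ (γ x)⁻¹ * h₀ k x, fun k ↦ ((hγ.inv hγ0).mul (hh₀ k)), fun x hx ↦ ?_⟩
    rw [hf₀ x hx]
    refine Finset.sum_congr rfl fun k _ ↦ ?_
    rw [hγu x hx k, mul_comm (γ x) _, mul_assoc, ← mul_assoc (γ x), mul_inv_cancel₀ (hγ0 x hx), one_mul]
  rcases hj.lt_or_eq with hjn | hjn
  · -- Case `j < n`: `u_j` is a unit on `W`
    set k₀ : Fin n := ⟨j, hjn⟩ with hk₀
    have hunit : ∀ x ∈ W, H.sectionCoord φ (hs k₀) a ((flagAtlas hφ H hs hflag).val x) ≠ 0 := fun x hx ↦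
      sectionCoord_prefixLen_ne_zero_of_mem hφ H hs hflag _ hjn
        (val_mem_flagChart_source_of_mem_chartSet hφ H hs hflag hx)
    have hWa : ∀ x ∈ W, (φ ((flagAtlas hφ H hs hflag).val x)).pt ∈ H.U a := fun x hx ↦
      flagChart_source_subset hφ H hs hflag _ (val_mem_flagChart_source_of_mem_chartSet hφ H hs hflag hx)
    have huk₀ : MDifferentiableOn 𝓘(ℂ, Fin n → ℂ) 𝓘(ℂ, ℂ) (fun x ↦ H.sectionCoord φ (hs k₀) a ((flagAtlas hφ H hs hflag).val x)) W :=
      (((flagAtlas hφ H hs hflag).mdifferentiableOn_comp_val_iff (u := H.sectionCoord φ (hs k₀) a)).2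
        (mdifferentiableOn_sectionCoord hφ (hs k₀) a)).mono fun x hx ↦ hWa x hx
    refine back (fun k x ↦ if k = k₀ then (H.sectionCoord φ (hs k₀) a ((flagAtlas hφ H hs hflag).val x))⁻¹ * f x else 0)
      (fun k ↦ ?_) fun x hx ↦ ?_
    · by_cases hk : k = k₀
      · simp only [hk, if_true]
        exact (huk₀.inv hunit).mul hf
      · simp only [hk, if_false]
        exact mdifferentiableOn_const
    · rw [Finset.sum_eq_single k₀]
      · simp only [if_true]
        field_simp [hunit x hx]
      · intro k _ hk
        simp only [hk, if_false, mul_zero]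
      · intro hk
        exact absurd (Finset.mem_univ k₀) hk
  · -- Case `j = n`: all coordinates are linear
    have hcoord : ∀ (k : Fin n), ∀ x ∈ W,
        H.sectionCoord φ (hs k) a ((flagAtlas hφ H hs hflag).val x) =
          (ContinuousLinearMap.proj (R := ℂ) (φ := fun _ : Fin n ↦ ℂ) k) (extChartAt 𝓘(ℝ, Fin n → ℂ) y₀ x) :=
      fun k x hx ↦ sectionCoord_val_eq_extChartAt hφ H hs hflag hx k (by rw [← hjdef, hjn]; exact k.is_lt)
    have hdual : ∀ k ∈ (Finset.univ : Finset (Fin n)), ∀ k' ∈ (Finset.univ : Finset (Fin n)),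
        (ContinuousLinearMap.proj (R := ℂ) (φ := fun _ : Fin n ↦ ℂ) k) ((Pi.single k' 1 : Fin n → ℂ)) =
          if k = k' then 1 else 0 := fun k _ k' _ ↦ by
      rw [ContinuousLinearMap.proj_apply, Pi.single_apply]
    have hf0' : ∀ x ∈ W, (∀ k ∈ (Finset.univ : Finset (Fin n)),
        (ContinuousLinearMap.proj (R := ℂ) (φ := fun _ : Fin n ↦ ℂ) k) (extChartAt 𝓘(ℝ, Fin n → ℂ) y₀ x) = 0) →
        f x = 0 := fun x hx h0 ↦ by
      refine hf0 x hx fun k ↦ ?_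
      rw [hγu x hx k, hcoord k x hx, h0 k (Finset.mem_univ k), mul_zero]
    obtain ⟨h₀, hh₀, hfh₀⟩ := exists_mdifferentiableOn_eq_sum_mul_of_forall_eq_zero_chartSet y₀ hCo hCc hCT
      (Finset.univ : Finset (Fin n)) (fun k ↦ ContinuousLinearMap.proj (R := ℂ) (φ := fun _ : Fin n ↦ ℂ) k)
      (fun k ↦ Pi.single k 1) hdual hf hf0'
    refine back h₀ hh₀ fun x hx ↦ ?_
    rw [hfh₀ x hx]
    exact Finset.sum_congr rfl fun k _ ↦ by rw [hcoord k x hx]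

end FlagChart

end TransverseFlag

end Literature.AlgebraicGeometry.HodgeTheory

end
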